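import Summits.ResolutionOfSingularities.ResolutionOfSingularities.Theorems.HilbertSamuelEliminationSigmaMaxModificationsCorridor3SigmaLocalChainsE
import HarnessLib

/-!
# [OURS · L1 W4.2] σ-LAYER — Ω-TRANSPORT brick 4C: the transfer row (T) and FINITE HITS for CARRIER LINEAGES (irreducible closed subsets of the strata,
# COMPONENTS AT HIT TIMES only — the (GL) form of plan-1's OBJECT FOREST: «curve lineages isolated at hit times, surface lineages, dimension jumps»)

Crux chain w42 (`SigmaMaxModifications`, stmt-ResolutionOfSingularities-18506; conjunct `SigmaMaxModificationsCorridor3`,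
stmt-ResolutionOfSingularities-19249), res-L1-w42-plan-1 RULINGS v3.14-26 (GL)/(GN), v3.14-28 (GS) (NC-b) «040 — `finiteHits_of_componentCarrier` in the
(GL) form». Typer res-type-040 (gen 19). Sibling of brick 4E `…SigmaLocalChainsE` (p532417; §2 there requires the members to be stratum components at
ALL stages) and of `…WLadderHybridLowTree` §3 (`finiteHits_of_componentCarrier`, p533837). OURS (cell res-hironaka, slot W4.2); NOT statements of
H. Hironaka's manuscript [Hironaka2017] nor of [CossartJannsenSaito2020]; AI-drafted, weaker than expert review. Sorry-free PROOF file: no definition,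
no named fact, no binder. Helper file `--supports stmt-ResolutionOfSingularities-19249` (counted 0).

HYPOTHESIS AUDIT of brick 4E §2 (why this generalisation is free): «`Z n ∈ componentsIn X_n(ν)`» is used only at HIT stages — to read the centre's
stalk at the generic point `ξ_n` as the maximal ideal (`C n` regular ⊆ `X_n(ν)` ⊇ the component `Z n`) and to see the closed point of
`Spec 𝒪_{X_n,ξ_n}` ISOLATED in its Hilbert–Samuel locus (proper generizations of the generic point of a COMPONENT have `H < ν`); everywhere else the
proof needs the member irreducible, closed, inside the stratum (generic points, heights, misses are local isomorphisms) and DOMINATION between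
consecutive members (generic point over generic point) — which tolerates dimension jumps. The kill row `Moving.LocalNearPointChainsTerminate` is about
chains of blow-ups of the CLOSED POINT of the successive local schemes with isolated closed points; it is NOT a termination statement for arbitrary
in-stratum sequences on a local surface (those need not terminate policy-free), which is why «component at hit times» cannot be dropped.

Contents (namespace `…Theorems.SigmaMaxModificationsCorridor3.Sigma`): `carrierLocalizes_of_blowupData`, `finiteHits_of_carrier`.
References: CJS LNM 2270 Lemma 6.30 (proof via `X_η`, p. 97), Prop. 6.31, p. 98 Step 9, p. 107 [CossartJannsenSaito2020]; Stacks 00GU, 02OS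
[StacksProject]; tree p532417, p533837, p513904 (res-type-053), `…WLadderLocalChainsTerminate` (res-D-pv-046).
-/

noncomputable section

set_option linter.dupNamespace false

open CategoryTheory CategoryTheory.Limits AlgebraicGeometry TopologicalSpace Topology IsLocalRing Order
open Summit.ResolutionOfSingularities.ResolutionOfSingularities.Theorems.CampaignW42
open Literature.AlgebraicGeometry.Resolution Literature.RingTheory.HilbertSamuel
open Literature.AlgebraicGeometry.CossartJannsenSaito2020
open Summit.ResolutionOfSingularities.ResolutionOfSingularities.Theorems.SigmaMaxModificationsCorridor3
open Summit.ResolutionOfSingularities.ResolutionOfSingularities.Theorems.SigmaMaxModificationsCorridor3.Moving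
open Scheme.IdealSheafData

namespace Summit.ResolutionOfSingularities.ResolutionOfSingularities.Theorems.SigmaMaxModificationsCorridor3.Sigma

universe u

variable {N : ℕ} {ν : ℕ → ℕ} {k : Type u} [Field k] {c : ℕ → MarkedStage.{u}}

/-- **THE TRANSFER ROW (T) FOR CARRIER LINEAGES — (GL) FORM, PROVED.** As `movingLineageLocalizes_of_blowupData` (brick 4E), but the members
`Z n` of the dominating lineage are only required to be IRREDUCIBLE CLOSED positive-dimensional subsets of the strata `X_n(ν)`; being an irreducible
COMPONENT of `X_n(ν)` is required AT HIT TIMES only (`Z n ⊆ V(C n)` ⇒ `Z n ∈ componentsIn X_n(ν)`: «isolated at hit times» — a curve member hit at a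
time when no surface component of the stratum contains it), the centre being regular and inside `X_n(ν)` when it hits. DIMENSION JUMPS along the
lineage (a curve dominated by a surface founded over it) are height jumps of the generic points, finitely many, before the tail read by the kill row.
Conclusion: an infinite chain of LOCAL near-point steps on `S_0` excellent, reduced, of dimension `≤ N − 1`, isolated closed points (plan-1 RULING
v3.14-26 (GL)/(GN) form, for res-L1-w42-stub-4's (E8-L) socket `localDim2Tail_of_surfaceBases`). [cite: CossartJannsenSaito2020, Lemma 6.30, Prop. 6.31, p. 107] -/
theorem carrierLocalizes_of_blowupData (hgood : ∀ n, RunGood k N ν (c n).W)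
    {f : ∀ n, (c (n + 1)).W ⟶ (c n).W} {C : ∀ n, (c n).W.IdealSheafData} (hb : ∀ n, IsBlowup (f n) (C n))
    {Z : ∀ n, Set (c n).W} (hZirr : ∀ n, IsIrreducible (Z n)) (hZcl : ∀ n, IsClosed (Z n))
    (hZν : ∀ n, Z n ⊆ Scheme.hsStratum (c n).W N ν) (hZnt : ∀ n, (Z n).Nontrivial)
    (hdom : ∀ n, closure ((f n).base '' Z (n + 1)) = Z n)
    (hZhit : ∀ n, Z n ⊆ ((C n).support : Set (c n).W) → Z n ∈ componentsIn (Scheme.hsStratum (c n).W N ν))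
    (hcen : ∀ n, Z n ⊆ ((C n).support : Set (c n).W) →
      Literature.AlgebraicGeometry.Resolution.Scheme.IsRegular (C n).subscheme ∧
        ((C n).support : Set (c n).W) ⊆ Scheme.hsStratum (c n).W N ν)
    (hhit : ∀ n, ∃ m, n ≤ m ∧ Z m ⊆ ((C m).support : Set (c m).W)) :
    ∃ (S : ℕ → Scheme.{u}) (ln : ∀ i, IsLocallyNoetherian (S i)) (pt : ∀ i, S i),
      Scheme.IsExcellent (S 0) ∧ IsReduced (S 0) ∧ topologicalKrullDim ↥(S 0) ≤ ((N - 1 : ℕ) : WithBot ℕ∞) ∧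
      IsLocalNearPointChain N S pt ∧ ∀ i, @IsIsolatedInHSMaxLocus (S i) (ln i) N (pt i) := by
  -- 1. stub-4's cycle invariant on the stages with their cycle state and labels forgotten (oracle-free fields only)
  have hinv : ∀ n, Moving.CycleInv k (fun _ _ => True) N ν ⟨(c n).W, (c n).ln, Labelling.init (c n).W, none, (c n).pt⟩ := fun n =>
    { overField := (hgood n).overField
      isReduced := (hgood n).isReduced
      dim_le := (hgood n).dim_le
      supMax := (hgood n).supMax
      label_le_year := fun _ => le_rfl
      pending := fun _ h => by cases h }
  -- 2. generic points, and a second point of each `Z n`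
  let η : ∀ n, (c n).W := fun n => (hZirr n).genericPoint
  have hη : ∀ n, IsGenericPoint (η n) (Z n) := fun n => by
    have h := (hZirr n).isGenericPoint_genericPoint_closure
    rwa [(hZcl n).closure_eq] at h
  have hover : ∀ n, (f n).base (η (n + 1)) = η n := base_genericPoint_of_dom hη hdom
  have hην : ∀ n, η n ∈ Scheme.hsStratum (c n).W N ν := fun n => hZν n (hη n).mem
  have hsnd : ∀ n, ∃ y ∈ Z n, y ≠ η n := fun n => by
    obtain ⟨a, ha, b, hb, hab⟩ := hZnt n
    by_cases h : a = η n
    · exact ⟨b, hb, fun hb' => hab (h.trans hb'.symm)⟩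
    · exact ⟨a, ha, h⟩
  have hhit' : ∀ n, ∃ m, n ≤ m ∧ η m ∈ ((C m).support : Set (c m).W) := fun n => by
    obtain ⟨m, hnm, hZC⟩ := hhit n
    exact ⟨m, hnm, hZC (hη m).mem⟩
  -- the tail on which fibres are «closed»
  obtain ⟨n₀, huniq⟩ := exists_forall_eq_genericPoint_of_specializes_of_isBlowup hb (fun n => (hgood n).dim_le) hη hdom
  -- 3. the hits after `n₀`, enumerated
  let P : ℕ → Prop := fun m => n₀ ≤ m ∧ η m ∈ ((C m).support : Set (c m).W)
  have hPinf : (setOf P).Infinite := by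
    refine Set.infinite_of_forall_exists_gt fun n => ?_
    obtain ⟨m, hnm, hm⟩ := hhit' (max n₀ n + 1)
    exact ⟨m, ⟨le_trans (le_max_left _ _) (Nat.le_of_succ_le hnm), hm⟩, lt_of_lt_of_le (Nat.lt_succ_of_le (le_max_right _ _)) hnm⟩
  let mH : ℕ → ℕ := Nat.nth P
  have hmH : ∀ i, P (mH i) := Nat.nth_mem_of_infinite hPinf
  have hmHmono : StrictMono mH := Nat.nth_strictMono hPinf
  have hmiss : ∀ i j, j < mH (i + 1) - (mH i + 1) →
      η (mH i + 1 + j) ∉ ((C (mH i + 1 + j)).support : Set (c (mH i + 1 + j)).W) := by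
    intro i j hj hmem
    have hlt : mH i + 1 + j < mH (i + 1) := by omega
    have hPm : P (mH i + 1 + j) := ⟨le_trans (hmH i).1 (by omega), hmem⟩
    have := Nat.le_nth_of_lt_nth_succ hlt hPm
    change mH i + 1 + j ≤ mH i at this
    omega
  -- the centre at a hit: radical with maximal stalk ideal at the generic point
  have hZC : ∀ i, Z (mH i) ⊆ ((C (mH i)).support : Set (c (mH i)).W) := fun i =>
    ((hη (mH i)).mem_closed_set_iff (C (mH i)).support.isClosed).mp (hmH i).2
  have hrad : ∀ i, C (mH i) = vanishingIdeal (C (mH i)).support := fun i =>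
    Helpers.eq_vanishingIdeal_support_of_isRegular_subscheme _ (hcen (mH i) (hZC i)).1
  -- 4. the local schemes
  let S : ℕ → Scheme.{u} := fun i => Spec ((c (mH i)).W.presheaf.stalk (η (mH i)))
  have ln : ∀ i, IsLocallyNoetherian (S i) := fun i => by
    haveI := (c (mH i)).ln
    show IsLocallyNoetherian (Spec _)
    infer_instance
  let pt : ∀ i, S i := fun i => closedPoint ((c (mH i)).W.presheaf.stalk (η (mH i)))
  refine ⟨S, ln, pt, (hinv (mH 0)).isExcellent_Spec_stalk _, (hinv (mH 0)).isReduced_Spec_stalk _, ?_, ?_, ?_⟩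
  · -- dimension `≤ N - 1`
    have hN : N ≤ N - 1 + 1 := by omega
    have hdim' : topologicalKrullDim (c (mH 0)).W ≤ ((N - 1 + 1 : ℕ) : WithBot ℕ∞) :=
      (hgood (mH 0)).dim_le.trans (by exact_mod_cast hN)
    obtain ⟨y, hy, hne⟩ := hsnd (mH 0)
    exact topologicalKrullDim_Spec_stalk_le_of_isGenericPoint (hη (mH 0)) hy hne (d := N - 1) hdim'
  · -- the chain of local near-point steps
    intro i
    have hgap : mH i + 1 + (mH (i + 1) - (mH i + 1)) = mH (i + 1) := by
      have hlt : mH i < mH (i + 1) := hmHmono (Nat.lt_succ_self i)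
      omega
    obtain ⟨e⟩ := nonempty_stalkIso_of_misses_of_isBlowup hb hover (mH i + 1) (mH (i + 1) - (mH i + 1)) (hmiss i)
    have hS' : IsLocalSchemeAt (S (i + 1)) (pt (i + 1)) (c (mH i + 1)).W (η (mH i + 1)) := by
      have e' : (c (mH i + 1)).W.presheaf.stalk (η (mH i + 1)) ≅ (c (mH (i + 1))).W.presheaf.stalk (η (mH (i + 1))) :=
        e ≪≫ eqToIso (by rw [hgap])
      exact isLocalSchemeAt_Spec_of_iso e'
    haveI : IsLocallyNoetherian (c (mH i)).W := (c (mH i)).ln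
    haveI : IsLocallyNoetherian (c (mH i + 1)).W := (c (mH i + 1)).ln
    have hnear : Scheme.hsFun (c (mH i + 1)).W N (η (mH i + 1)) = Scheme.hsFun (c (mH i)).W N (η (mH i)) := by
      rw [Scheme.mem_hsStratum_iff.mp (hην (mH i + 1)), Scheme.mem_hsStratum_iff.mp (hην (mH i))]
    exact isLocalNearPointStep_of_isBlowup (hb (mH i)) (hrad i)
      (stalkIdeal_eq_maximalIdeal_of_isGenericPoint_of_isRegular _ (hcen (mH i) (hZC i)).1
        (mem_componentsIn_of_subset (hZhit (mH i) (hZC i)) (hcen (mH i) (hZC i)).2 (hZC i)) (hη (mH i)))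
      N (hover (mH i)) hnear (huniq (mH i) (hmH i).1) hS'
  · -- isolation
    intro i
    exact (hinv (mH i)).isIsolatedInHSMaxLocus_closedPoint_of_isGenericPoint (hZhit (mH i) (hZC i)) (hη (mH i))

/-- **(GL) FINITE HITS OF A CARRIER LINEAGE — PROVED modulo the kill row.** Along blow-up data on GOOD stages of level `0 < N ≤ 3`, a dominating
lineage of positive-dimensional irreducible closed subsets `Z n ⊆ X_n(ν)` is contained in the centre only finitely often, PROVIDED at every hit
`Z n` is an irreducible COMPONENT of `X_n(ν)` («isolated at hit times») and the centre is regular and inside `X_n(ν)`. No strategy, no functionality,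
no marked point; surface lineages, curve lineages under (P1)-first, dimension jumps alike (plan-1 RULING v3.14-26 (GL), (NC-b) of v3.14-28 (GS)).
[cite: CossartJannsenSaito2020, Lemma 6.30, p. 98 Step 9, p. 107] -/
theorem finiteHits_of_carrier (hK : LocalNearPointChainsTerminate.{u}) (hN0 : 0 < N) (hN3 : N ≤ 3) (hgood : ∀ n, RunGood k N ν (c n).W)
    {f : ∀ n, (c (n + 1)).W ⟶ (c n).W} {C : ∀ n, (c n).W.IdealSheafData} (hb : ∀ n, IsBlowup (f n) (C n))
    {Z : ∀ n, Set (c n).W} (hZirr : ∀ n, IsIrreducible (Z n)) (hZcl : ∀ n, IsClosed (Z n))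
    (hZν : ∀ n, Z n ⊆ Scheme.hsStratum (c n).W N ν) (hZnt : ∀ n, (Z n).Nontrivial)
    (hdom : ∀ n, closure ((f n).base '' Z (n + 1)) = Z n)
    (hZhit : ∀ n, Z n ⊆ ((C n).support : Set (c n).W) → Z n ∈ componentsIn (Scheme.hsStratum (c n).W N ν))
    (hcen : ∀ n, Z n ⊆ ((C n).support : Set (c n).W) →
      Literature.AlgebraicGeometry.Resolution.Scheme.IsRegular (C n).subscheme ∧
        ((C n).support : Set (c n).W) ⊆ Scheme.hsStratum (c n).W N ν) :
    ∃ n₀, ∀ n, n₀ ≤ n → ¬ Z n ⊆ ((C n).support : Set (c n).W) := by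
  by_contra h
  push Not at h
  obtain ⟨S, ln, pt, hexc, hred, hdim, hchain, hiso⟩ :=
    carrierLocalizes_of_blowupData hgood hb hZirr hZcl hZν hZnt hdom hZhit hcen h
  have h1 : ((N - 1 : ℕ) : WithBot ℕ∞) ≤ (2 : WithBot ℕ∞) := by
    have : N - 1 ≤ 2 := by omega
    exact_mod_cast this
  have h2 : ((N - 1 : ℕ) : WithBot ℕ∞) < (N : WithBot ℕ∞) := by
    have : N - 1 < N := by omega
    exact_mod_cast this
  exact hK N S ln pt hexc hred (hdim.trans h1) (lt_of_le_of_lt hdim h2) hchain hiso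

/-- Brick 4E's component form is the special case «component at all stages». [folklore] -/
theorem finiteHits_of_carrier_of_components (hK : LocalNearPointChainsTerminate.{u}) (hN0 : 0 < N) (hN3 : N ≤ 3)
    (hgood : ∀ n, RunGood k N ν (c n).W)
    {f : ∀ n, (c (n + 1)).W ⟶ (c n).W} {C : ∀ n, (c n).W.IdealSheafData} (hb : ∀ n, IsBlowup (f n) (C n))
    {Z : ∀ n, Set (c n).W} (hZ : ∀ n, Z n ∈ componentsIn (Scheme.hsStratum (c n).W N ν))
    (hZnt : ∀ n, (Z n).Nontrivial) (hdom : ∀ n, closure ((f n).base '' Z (n + 1)) = Z n)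
    (hcen : ∀ n, Z n ⊆ ((C n).support : Set (c n).W) →
      Literature.AlgebraicGeometry.Resolution.Scheme.IsRegular (C n).subscheme ∧
        ((C n).support : Set (c n).W) ⊆ Scheme.hsStratum (c n).W N ν) :
    ∃ n₀, ∀ n, n₀ ≤ n → ¬ Z n ⊆ ((C n).support : Set (c n).W) :=
  finiteHits_of_carrier hK hN0 hN3 hgood hb (fun n => componentsIn.isIrreducible (hZ n))
    (fun n => componentsIn.isClosed (hgood n).isClosed_hsStratum (hZ n)) (fun n => componentsIn.subset (hZ n)) hZnt hdom
    (fun n _ => hZ n) hcen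

end Summit.ResolutionOfSingularities.ResolutionOfSingularities.Theorems.SigmaMaxModificationsCorridor3.Sigma

end
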